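import Summits.AtomisticToContinuum.Crystallization.Theorems.ChargedEnergyGapRidgeAtlas
import Summits.AtomisticToContinuum.Crystallization.Theorems.ChargedEnergyGapZB1W11A
import HarnessLib

/-!
# ChargedEnergyGap · NODE 113U «LeafFrames» — the CANONICAL FRAME of every ridge-atlas leaf (all 4 slabs × 6 windows × 8 bands), kernel-checked
to cover its leaf, and the generic leaf law from ANY checked tiling of that frame: the exact row SPEC for every unit still to be made

decomp-a2c lens-3 g97.  Line of record `stmt-AtomisticToContinuum-14231`; deciding leaf (T¹ᶜ) `StencilChartLawQ 130 (1/60000000) 160 (3/100)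
(679/1000) (691/1000)`; residual of record (113S) = 7 zone laws + the open leaves of the 192-box ridge atlas (113R).  Beneath: 113R
(`atlasBox`, `up3`, `boxLaw_of_frame`), 113N (`GBox.clip`, `coversG`, `GridTree`, `coversT`, `LawTile`, `law_of_tiles`).  NO new mathematics,
no Prop-valued defs, no `instance` / notation / `set_option`.

WHAT.  (1) `GBox.tHi A = ⌈C₁ + ρ₁²/(2C₁)⌉₃` (a rational majorant of `√(C₁² + ρ₁²)`, the sphere row of `coversG`) and ★ `GBox.frameRows A :
StationRowsCert` = THE CANONICAL ROWS of a box: slab `[r0, r1]`, slot `0` window, centre band `[c0, c1]`, transverse `T_a ∈ [c0 − r1, tHi]`,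
`F_a ∈ [(t0 + f0)/2, c1 + r1]` (`a = 1, 2`), no tangent / secant / oracle rows.  (2) ★★ `atlasFrame_check : ∀ s i j b, (GridTree.frame 0).check
130 [(atlasBox s i j b).frameRows] (atlasBox s i j b) = true` and the tighter ★ `atlasClipFrame_check` (rows of the CLIPPED leaf) — ONE `decide
+kernel` each over all `4·3·3·8 = 288` parameter tuples (the 192 atlas leaves are the `i ≤ j` ones).  (3) ★★★ `atlasLaw_of_tiles s i j b tiles t
(ht : t.check F tiles F.tbox = true) (hlaws : tile laws) : LAW⁺(atlasBox s i j b, 1/6e7)` with `F` the canonical frame, and `atlasLaw_of_clipTiles`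
with the clipped frame — every atlas leaf closes the moment a checked tile list over its canonical frame is in the tree (a single unit `U` is the
tile list `[U.R]` with the tree `.tile 0`).  (4) worked check: the landed unit `ZB1W11` IS the one-tile tiling of the canonical frame of its CLIPPED leaf
(`coversT` by kernel; the nominal frame's centre row starts `1/4000` lower — kernel `= false`) and its leaf law re-derives through (3): the
clipped canonical frame is exactly the emitter's row formula.
The per-leaf numeric table (nominal and clipped rows) is `decomp-a2c-lens-3/g97/num/frames97.out` (generator `mkatlas97.py --frames`).
-/

namespace Summit.AtomisticToContinuum.Crystallization.Theorems.ChargedEnergyGapChartDial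

open scoped Classical
open Literature.MathematicalPhysics.StatisticalMechanics Literature.Geometry.DiscreteGeometry
open Summit.AtomisticToContinuum.Crystallization.Theses.PricedLinkCensus
open Summit.AtomisticToContinuum.Crystallization.Theorems.ChargedEnergyGapNegative

/-! ## §113U.1 Canonical rows of a box -/
section Frames

/-- transverse `T` upper row `⌈C₁ + ρ₁²/(2C₁)⌉₃` — a rational majorant of `√(C₁² + ρ₁²)` (`(C₁ + ρ₁²/(2C₁))² = C₁² + ρ₁² + ρ₁⁴/(4C₁²)`). -/
def GBox.tHi (A : GBox) : ℚ := up3 (A.c1 + A.r1 ^ 2 / (2 * A.c1))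

/-- ★ THE CANONICAL ROWS (H-description frame) of a box: slab, slot-`0` window, centre band, transverse envelope
`T_a ∈ [c0 − r1, tHi]`, `F_a ∈ [(t0 + f0)/2, c1 + r1]` (`a = 1, 2`); no tangent / secant / oracle rows. -/
def GBox.frameRows (A : GBox) : StationRowsCert :=
  ⟨A.r0, A.r1, sextQ A.t0 A.f0 (A.c0 - A.r1) ((A.t0 + A.f0) / 2) (A.c0 - A.r1) ((A.t0 + A.f0) / 2),
    sextQ A.t1 A.f1 A.tHi (A.c1 + A.r1) A.tHi (A.c1 + A.r1), A.c0, A.c1, [], [], []⟩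

/-- every atlas slab is a positive `ρ` range. -/
theorem atlasBox_r0_pos : ∀ (s : Fin 4) (i j : Fin 3) (b : Fin 8), 0 < (atlasBox s i j b).r0 := by decide +kernel

/-- ★★ THE CANONICAL FRAME COVERS ITS LEAF, for every slab / window pair / band (113N `coversG` of the clipped leaf, incl. the sphere row; kernel,
all `288` tuples at once). -/
theorem atlasFrame_check : ∀ (s : Fin 4) (i j : Fin 3) (b : Fin 8),
    (GridTree.frame 0).check 130 [(atlasBox s i j b).frameRows] (atlasBox s i j b) = true := by
  decide +kernel

/-- ★ … and so does the (tighter) canonical frame of the CLIPPED leaf (113N `GBox.clip 130`: admissibility, Lipschitz and pole-order cuts). -/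
theorem atlasClipFrame_check : ∀ (s : Fin 4) (i j : Fin 3) (b : Fin 8),
    (GridTree.frame 0).check 130 [((atlasBox s i j b).clip 130).frameRows] (atlasBox s i j b) = true := by
  decide +kernel

/-- MUST-FAIL twin: the transverse `T` row lowered by `1/1000` breaks the sphere row (slab D, window W22, band 7). -/
example : (GridTree.frame 0).check 130 [{ (atlasBox 3 2 2 7).frameRows with
    hi := sextQ (atlasBox 3 2 2 7).t1 (atlasBox 3 2 2 7).f1 ((atlasBox 3 2 2 7).tHi - 1 / 1000) ((atlasBox 3 2 2 7).c1 + 691 / 1000)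
      ((atlasBox 3 2 2 7).tHi - 1 / 1000) ((atlasBox 3 2 2 7).c1 + 691 / 1000) }] (atlasBox 3 2 2 7) = false := by
  decide +kernel

end Frames

/-! ## §113U.2 ★★★ A leaf law from any checked tiling of the canonical frame -/
section Assembly

/-- ★★★ **ATLAS LEAF LAW FROM TILES**: a tile list with a checked 113N tile tree over the canonical frame's transverse box, each tile carrying
its (113L/113M) unit law, gives LAW⁺ of the atlas leaf `atlasBox s i j b` — plug into 113S′ as `atlasLaw_s_i_j_b`.  A single unit `U` is
`tiles := [U.R]`, `t := .tile 0` (then `ht` is `coversT`). -/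
theorem atlasLaw_of_tiles (s : Fin 4) (i j : Fin 3) (b : Fin 8) (tiles : List StationRowsCert) (t : LawTile)
    (ht : t.check (atlasBox s i j b).frameRows tiles (atlasBox s i j b).frameRows.tbox = true)
    (hlaws : ∀ S ∈ tiles, ∀ ρ : ℝ, (S.rho0 : ℝ) ≤ ρ → ρ ≤ S.rho1 → ∀ dt : (Fin 3 → ℤ) → ℝ,
      (∀ q, castW S.lo q ≤ dt (holeVertex 0 q) ∧ dt (holeVertex 0 q) ≤ castW S.hi q) → ((S.loC : ℝ) ≤ dt 0 ∧ dt 0 ≤ S.hiC) →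
      IsChartRealisable ρ dt → (∀ p ∈ stencil 0, 0 < dt p) → poleSum dt 0 ≤ poleSum dt 1 → poleSum dt 0 ≤ poleSum dt 2 →
      (∀ a : Fin 3, dt (holeVertex 0 (a, true)) ≤ dt (holeVertex 0 (a, false))) →
      feetHoleCost 160 (3 / 100) ρ dt 0 ≤ domCapK ((1 / 60000000 : ℚ) : ℝ) 160 (3 / 100) ρ (chargeDepth ρ dt 0)) :
    ∀ ρ : ℝ, ((atlasBox s i j b).r0 : ℝ) ≤ ρ → ρ ≤ (atlasBox s i j b).r1 → ∀ dt : (Fin 3 → ℤ) → ℝ,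
      ((atlasBox s i j b).t0 : ℝ) ≤ dt (holeVertex 0 (0, true)) → dt (holeVertex 0 (0, true)) ≤ (atlasBox s i j b).t1 →
      ((atlasBox s i j b).f0 : ℝ) ≤ dt (holeVertex 0 (0, false)) → dt (holeVertex 0 (0, false)) ≤ (atlasBox s i j b).f1 →
      ((atlasBox s i j b).c0 : ℝ) ≤ dt 0 → dt 0 ≤ (atlasBox s i j b).c1 →
      IsChartRealisable ρ dt → (∀ p ∈ stencil 0, 0 < dt p) → poleSum dt 0 ≤ poleSum dt 1 → poleSum dt 0 ≤ poleSum dt 2 →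
      (∀ a : Fin 3, dt (holeVertex 0 (a, true)) ≤ dt (holeVertex 0 (a, false))) → IsTupleHole ((130 : ℚ) : ℝ) ρ dt →
      feetHoleCost 160 (3 / 100) ρ dt 0 ≤ domCapK ((1 / 60000000 : ℚ) : ℝ) 160 (3 / 100) ρ (chargeDepth ρ dt 0) :=
  boxLaw_of_frame _ (atlasBox_r0_pos s i j b) _ (atlasFrame_check s i j b) (StationRowsCert.law_of_tiles ht hlaws)

/-- ★★★ the same from a checked tiling of the CLIPPED leaf's canonical frame (tighter rows ⇒ cheaper units). -/
theorem atlasLaw_of_clipTiles (s : Fin 4) (i j : Fin 3) (b : Fin 8) (tiles : List StationRowsCert) (t : LawTile)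
    (ht : t.check ((atlasBox s i j b).clip 130).frameRows tiles ((atlasBox s i j b).clip 130).frameRows.tbox = true)
    (hlaws : ∀ S ∈ tiles, ∀ ρ : ℝ, (S.rho0 : ℝ) ≤ ρ → ρ ≤ S.rho1 → ∀ dt : (Fin 3 → ℤ) → ℝ,
      (∀ q, castW S.lo q ≤ dt (holeVertex 0 q) ∧ dt (holeVertex 0 q) ≤ castW S.hi q) → ((S.loC : ℝ) ≤ dt 0 ∧ dt 0 ≤ S.hiC) →
      IsChartRealisable ρ dt → (∀ p ∈ stencil 0, 0 < dt p) → poleSum dt 0 ≤ poleSum dt 1 → poleSum dt 0 ≤ poleSum dt 2 →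
      (∀ a : Fin 3, dt (holeVertex 0 (a, true)) ≤ dt (holeVertex 0 (a, false))) →
      feetHoleCost 160 (3 / 100) ρ dt 0 ≤ domCapK ((1 / 60000000 : ℚ) : ℝ) 160 (3 / 100) ρ (chargeDepth ρ dt 0)) :
    ∀ ρ : ℝ, ((atlasBox s i j b).r0 : ℝ) ≤ ρ → ρ ≤ (atlasBox s i j b).r1 → ∀ dt : (Fin 3 → ℤ) → ℝ,
      ((atlasBox s i j b).t0 : ℝ) ≤ dt (holeVertex 0 (0, true)) → dt (holeVertex 0 (0, true)) ≤ (atlasBox s i j b).t1 →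
      ((atlasBox s i j b).f0 : ℝ) ≤ dt (holeVertex 0 (0, false)) → dt (holeVertex 0 (0, false)) ≤ (atlasBox s i j b).f1 →
      ((atlasBox s i j b).c0 : ℝ) ≤ dt 0 → dt 0 ≤ (atlasBox s i j b).c1 →
      IsChartRealisable ρ dt → (∀ p ∈ stencil 0, 0 < dt p) → poleSum dt 0 ≤ poleSum dt 1 → poleSum dt 0 ≤ poleSum dt 2 →
      (∀ a : Fin 3, dt (holeVertex 0 (a, true)) ≤ dt (holeVertex 0 (a, false))) → IsTupleHole ((130 : ℚ) : ℝ) ρ dt →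
      feetHoleCost 160 (3 / 100) ρ dt 0 ≤ domCapK ((1 / 60000000 : ℚ) : ℝ) 160 (3 / 100) ρ (chargeDepth ρ dt 0) :=
  boxLaw_of_frame _ (atlasBox_r0_pos s i j b) _ (atlasClipFrame_check s i j b) (StationRowsCert.law_of_tiles ht hlaws)

end Assembly

/-! ## §113U.3 Worked check: a landed unit is the one-tile tiling of its leaf's clipped canonical frame -/
section Worked

/-- ★ the landed unit `ZB1W11` (slab FD, window W11, band 1) tiles the canonical frame of its CLIPPED leaf in ONE tile (113N `coversT`;
kernel) — the clipped canonical rows ARE the emitter's rows (centre from `max (edge₀, (T₀lo + F₀lo + ρ₀)/2) = 118.45625`). -/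
theorem zb1w11_tiles_clipFrame :
    (LawTile.tile 0).check ((atlasBox 2 1 1 0).clip 130).frameRows [ZB1W11.U.R] ((atlasBox 2 1 1 0).clip 130).frameRows.tbox = true := by
  decide +kernel

/-- … and NOT the nominal frame (its centre row starts at the band edge `⌊118.45625⌋₃ = 118.456`, `1/4000` below the unit's): band-1 units are
emitted on the clipped centre range — use `atlasLaw_of_clipTiles` for them. -/
example : (LawTile.tile 0).check (atlasBox 2 1 1 0).frameRows [ZB1W11.U.R] (atlasBox 2 1 1 0).frameRows.tbox = false := by
  decide +kernel

/-- ★ the leaf law of `atlasBox 2 1 1 0` re-derived through `atlasLaw_of_clipTiles` (same statement as 113S `atlasLaw_2_1_1_0`). -/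
example : ∀ ρ : ℝ, ((atlasBox 2 1 1 0).r0 : ℝ) ≤ ρ → ρ ≤ (atlasBox 2 1 1 0).r1 → ∀ dt : (Fin 3 → ℤ) → ℝ,
      ((atlasBox 2 1 1 0).t0 : ℝ) ≤ dt (holeVertex 0 (0, true)) → dt (holeVertex 0 (0, true)) ≤ (atlasBox 2 1 1 0).t1 →
      ((atlasBox 2 1 1 0).f0 : ℝ) ≤ dt (holeVertex 0 (0, false)) → dt (holeVertex 0 (0, false)) ≤ (atlasBox 2 1 1 0).f1 →
      ((atlasBox 2 1 1 0).c0 : ℝ) ≤ dt 0 → dt 0 ≤ (atlasBox 2 1 1 0).c1 →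
      IsChartRealisable ρ dt → (∀ p ∈ stencil 0, 0 < dt p) → poleSum dt 0 ≤ poleSum dt 1 → poleSum dt 0 ≤ poleSum dt 2 →
      (∀ a : Fin 3, dt (holeVertex 0 (a, true)) ≤ dt (holeVertex 0 (a, false))) → IsTupleHole ((130 : ℚ) : ℝ) ρ dt →
      feetHoleCost 160 (3 / 100) ρ dt 0 ≤ domCapK ((1 / 60000000 : ℚ) : ℝ) 160 (3 / 100) ρ (chargeDepth ρ dt 0) :=
  atlasLaw_of_clipTiles 2 1 1 0 [ZB1W11.U.R] (.tile 0) zb1w11_tiles_clipFrame (by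
    intro S hS
    rw [List.mem_singleton] at hS
    subst hS
    exact ZB1W11.U_law)

end Worked

end Summit.AtomisticToContinuum.Crystallization.Theorems.ChargedEnergyGapChartDial
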